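import Mathlib
import Summits.ValiantsHypothesis.ValiantsHypothesis.Theses.NewtonUnitEquations
import Summits.ValiantsHypothesis.ValiantsHypothesis.Theorems.NewtonTauWeak.Negative.Zonogon

/-!
# Line `aligned-peeling` for crux `NewtonUnitEquations.NewtonTauWeak` (stmt-ValiantsHypothesis-5904)

Crux-strategist line (planner-cstrat-stmt-ValiantsHypothesis-5904-0, 2026-08-16).  Card: `Lines/aligned-peeling.md`.

THE IDEA IN ONE LINE.  Spend the crux's `2^{a m}` budget as an INDUCTION ON THE NUMBER OF FACTORS that loses a
CONSTANT factor per factor: `T(ℓ+1) ≤ C · T(ℓ) + (k t + 2)^c` gives `T(m) ≤ (C+1)^m (k + m (k t+2)^c) ≤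
2^{(C+2) m}(k t+2)^{c+1}` — exactly the weak shape, uniformly in `k` BY STRUCTURE (the number of products never changes
along the induction; no Fischer / duality blow-up `k ↦ k·2^m(mt+1)`, no Wronskian of `k` functions).  The whole content
is the ONE-STEP statement `AlignedPeeling C c` (stub `stub_alignedPeeling`, OPEN, hardest):

  for a `k`-tuple of products `G_i = Π_{j<ℓ} g_ij` of `t`-sparse bivariate polynomials and `t`-sparse multipliers `p_i`,
  `vert(Σ_i p_i G_i) ≤ C · V + (k t + 2)^c` whenever `V` bounds the vertex count of EVERY ALIGNED COMBINATION
  `Σ_i d_i X^{a_i} G_i` (one monomial shift and one scalar per component).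

Why the hypothesis is the right potential (and not a costume): (1) `k = 1` is Ostrowski (`Newt(p G) = Newt p + Newt G`,
`C = 1`, additive `t`); (2) the naive potentials — vertex counts of the `G_i`, greedy/shadow counts of the coefficient-vector
configuration `e ↦ (G_i(e))_i` — are DESTROYED by one monomial shift (`(X^a P, λP + S) ⊙ (1, X^a)` exposes any hidden `S`:
card §2), and the aligned family `Σ d_i X^{a_i} G_i` is the smallest shift-stable one; (3) for a generic direction `w` the
products whose shifted tops tie at the top weight involve each `G_i` with at most ONE shift (distinct shifts of one `G_i` have
distinct `w`-tops), so the first cancelling layer of `Σ p_i G_i` is literally an aligned combination — `V` controls it, and the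
stub asks that the deeper layers cost a constant factor and `poly(k t)` new vertices, not more; (4) the statement is FALSE
for general (non-product) polynomials `G_i` (card §4: a banded pair `(P, Q)` with `t` ratio bands gives `vert(P f₁ − Q f₂) ≈ t·V`),
so it has genuine product-specific content; the crux does NOT imply it (its right-hand side can be far below the crux bound),
and it implies the crux (this file).  It dodges the stuck goal of the live line (`stub_binomialNewtonTauCommon` = KPTT at
`t = 2` uniformly in `K = k 2^m(mt+1)` products; fixed-`K` coincidence layers) by never leaving the `(k, m, t)` presentation.

Stubs (registered): `stub_alignedPeeling` (XL, open, HARDEST), `stub_peelInduction` (M, provable now: the induction above,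
`Fin.prod_univ_castSucc` + absorbing `monomial (a i) (d i)` into the last factor + the arithmetic).  Composition
`NewtonTauWeak_of` is kernel-checked (no `sorry`).  Calibration proved here: `vert_sum_monomial_le` (level `0` of the
induction: `vert(Σ_i d_i X^{a_i}) ≤ k`), `alignedBound_mono`, `alignedPeeling_mono`.

Disproof used (`Cruxes/NewtonTauWeak/Disproof.lean`): §A `newtonTauWeak_false_without_sparsity` honoured — `t` enters the
additive term `(k t+2)^c` of every step and the sparsity of `p_i`; §B/§C `not_newtonTauBoundNoM/NoK/NoT` honoured — the
composed bound keeps `2^{(C+2)m}` (the zonogon `Π_{j<m}(1 + X Y^j)`, `k = 1`, forces `≥ 2m`: here it is paid by the `m`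
additive terms `(k t+2)^c`, i.e. the induction is tight in shape at `k = 1` with `C = 1`), and `k, t` enter `(k t+2)^{c+1}`.
No stub is an instance of a landed `Negative/*` lemma (`NewtonTauBoundNoM` has `a = 0`; `AlignedPeeling` at `ℓ = 0`
is the trivial `vert ≤ k t`).
-/

set_option linter.dupNamespace false

namespace Summit.ValiantsHypothesis.ValiantsHypothesis.Cruxes.NewtonTauWeak.AlignedPeeling

open scoped BigOperators
open MvPolynomial
open Summit.ValiantsHypothesis.ValiantsHypothesis.Theses.NewtonUnitEquations (NewtonTauWeak)
open Summit.ValiantsHypothesis.ValiantsHypothesis.Theorems.NewtonTauWeak.Negative (vert vert_le_card_support)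

noncomputable section

/-! ### Statements -/

/-- The crux's bound with FIXED constants `(a, b)` (same `SpsBound` as line `binomial-normal-form`):
`vert(Σ_{i<k} Π_{j<m} f_ij) ≤ 2^{a m}(k t+2)^b` for `t`-sparse `f_ij`.  `NewtonTauWeak` is `∃ a b, SpsBound a b`. -/
def SpsBound (a b : ℕ) : Prop :=
  ∀ (k m t : ℕ) (f : Fin k → Fin m → MvPolynomial (Fin 2) ℂ),
    (∀ i j, (f i j).support.card ≤ t) → vert (∑ i, ∏ j, f i j) ≤ 2 ^ (a * m) * (k * t + 2) ^ b

/-- ALIGNED-COMBINATION BOUND: `V` bounds the Newton vertex count of every combination `Σ_i d_i X^{a_i} · Π_j g_ij` of the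
`k` products with ONE monomial shift `a_i` and ONE scalar `d_i` per component (`d_i = 0` drops a component). -/
def AlignedBound {k ℓ : ℕ} (g : Fin k → Fin ℓ → MvPolynomial (Fin 2) ℂ) (V : ℕ) : Prop :=
  ∀ (a : Fin k → (Fin 2 →₀ ℕ)) (d : Fin k → ℂ), vert (∑ i, monomial (a i) (d i) * ∏ j, g i j) ≤ V

/-- ALIGNED PEELING with constants `(C, c)` — the line's one-step statement: multiplying each of `k` products of `ℓ`
`t`-sparse factors by its own `t`-sparse multiplier `p_i` and summing creates at most `C · V + (k t + 2)^c` Newton vertices,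
where `V` is any aligned-combination bound of the tuple of products.  (`k = 1`: Ostrowski with `C = 1`; false for
non-product `G_i`; implies the crux by induction on `ℓ`, `stub_peelInduction`.) -/
def AlignedPeeling (C c : ℕ) : Prop :=
  ∀ (k ℓ t V : ℕ) (g : Fin k → Fin ℓ → MvPolynomial (Fin 2) ℂ) (p : Fin k → MvPolynomial (Fin 2) ℂ),
    (∀ i j, (g i j).support.card ≤ t) → (∀ i, (p i).support.card ≤ t) → AlignedBound g V →
      vert (∑ i, p i * ∏ j, g i j) ≤ C * V + (k * t + 2) ^ c

/-! ### Registered stubs (`sorry` lives only here) -/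

/-- STUB 1 (HARDEST, open; the line's crux).  Some constants `(C, c)` make aligned peeling hold: one sparse multiplication
step costs a CONSTANT factor on the best aligned vertex count plus `poly(k t)` fresh vertices.  Size: XL / open-problem
(at `ℓ ≥ 2`, `k = 2` it contains KPTT's §5 questions in the weak shape; it implies `TwoProducts` at `k = 2` and the crux
for all `k`).  Cheapest falsifier: exact search at `k = 2`, `ℓ ∈ {1,2,3}`, `t ∈ {2,3,4}` for pairs with
`vert(p₁G₁ + p₂G₂) − max_{a,λ} vert(G₁ − λ X^a G₂)` growing (kit probe `aligned_probe.py`, card §5). -/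
theorem stub_alignedPeeling : ∃ C c : ℕ, AlignedPeeling C c := by
  sorry

/-- STUB 2 (M, provable now).  PEEL INDUCTION: aligned peeling with constants `(C, c)` gives the crux's bound with
`(a, b) = (C + 2, c + 1)`.  Proof: by induction on `ℓ` prove `vert(Σ_i d_i X^{a_i} Π_{j<ℓ} g_ij) ≤ B(ℓ)` with
`B(0) = k` (`vert_sum_monomial_le`) and `B(ℓ+1) = C·B(ℓ) + (k t+2)^c` — split `Π_{j ≤ ℓ} = (Π_{j<ℓ}) · g_{iℓ}`
(`Fin.prod_univ_castSucc`), absorb `monomial (a i) (d i)` into the last factor (`p_i := monomial (a i) (d i) * g i (last ℓ)`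
is `t`-sparse: `support_monomial_mul`-type inclusion), apply `AlignedPeeling` with `V := B(ℓ)`; finally
`B(m) ≤ (C+1)^m (k + m (k t+2)^c) ≤ 2^{(C+2) m} (k t+2)^{c+1}` and `a i = 0, d i = 1` recovers `Σ_i Π_j f_ij`. -/
theorem stub_peelInduction : ∀ C c : ℕ, AlignedPeeling C c → SpsBound (C + 2) (c + 1) := by
  sorry

/-! ### Name-keyed aliases of the stub statements (the hypotheses of the composition; the skeleton audit admits a
hypothesis only if its head constant is a registered obligation or is named like a declared stub) -/
namespace Registered

/-- Alias of the statement of STUB 1, keyed by the registered stub name. -/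
abbrev stub_alignedPeeling : Prop := ∃ C c : ℕ, AlignedPeeling C c

/-- Alias of the statement of STUB 2, keyed by the registered stub name. -/
abbrev stub_peelInduction : Prop := ∀ C c : ℕ, AlignedPeeling C c → SpsBound (C + 2) (c + 1)

end Registered

/-! ### Composition (PROVED): the stubs give the crux BY NAME -/

/-- The registered stubs compose to the crux `NewtonUnitEquations.NewtonTauWeak` (literally the route decl):
`NewtonTauWeak` is `∃ a b, SpsBound a b` definitionally (`vert` is the crux's literal subterm). -/
theorem NewtonTauWeak_of (h₁ : Registered.stub_alignedPeeling) (h₂ : Registered.stub_peelInduction) :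
    NewtonTauWeak := by
  obtain ⟨C, c, h⟩ := h₁
  exact ⟨C + 2, c + 1, fun k m t f hf => h₂ C c h k m t f hf⟩

/-- The crux from the stubs as they stand (`sorry` only inside `stub_*`). -/
theorem NewtonTauWeak_of_stubs : NewtonTauWeak :=
  NewtonTauWeak_of stub_alignedPeeling stub_peelInduction

/-! ### Calibration (PROVED) -/

/-- Monotonicity of the aligned bound in `V`. -/
theorem alignedBound_mono {k ℓ : ℕ} {g : Fin k → Fin ℓ → MvPolynomial (Fin 2) ℂ} {V V' : ℕ} (hV : V ≤ V')
    (h : AlignedBound g V) : AlignedBound g V' :=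
  fun a d => (h a d).trans hV

/-- Monotonicity of aligned peeling in the constants. -/
theorem alignedPeeling_mono {C c C' c' : ℕ} (hC : C ≤ C') (hc : c ≤ c') (h : AlignedPeeling C c) :
    AlignedPeeling C' c' := by
  intro k ℓ t V g p hg hp hV
  calc vert (∑ i, p i * ∏ j, g i j) ≤ C * V + (k * t + 2) ^ c := h k ℓ t V g p hg hp hV
    _ ≤ C' * V + (k * t + 2) ^ c' :=
        add_le_add (Nat.mul_le_mul_right _ hC) (Nat.pow_le_pow_right (by omega) hc)

/-- LEVEL ZERO of the peel induction: a sum of `k` monomials has at most `k` Newton vertices. -/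
theorem vert_sum_monomial_le (k : ℕ) (a : Fin k → (Fin 2 →₀ ℕ)) (d : Fin k → ℂ) :
    vert (∑ i, monomial (a i) (d i)) ≤ k := by
  classical
  calc vert (∑ i, monomial (a i) (d i)) ≤ (∑ i, monomial (a i) (d i)).support.card := vert_le_card_support _
    _ ≤ (Finset.univ.biUnion fun i : Fin k => (monomial (a i) (d i)).support).card :=
        Finset.card_le_card MvPolynomial.support_sum
    _ ≤ ∑ i : Fin k, (monomial (a i) (d i)).support.card := Finset.card_biUnion_le
    _ ≤ ∑ _i : Fin k, 1 := Finset.sum_le_sum fun i _ =>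
        (Finset.card_le_card (support_monomial_subset)).trans (by simp)
    _ = k := by simp

/-- The level-`0` instance of `AlignedBound`: the empty products are `1`, so `V := k` is an aligned bound. -/
theorem alignedBound_zero (k : ℕ) (g : Fin k → Fin 0 → MvPolynomial (Fin 2) ℂ) : AlignedBound g k := by
  intro a d
  simpa using vert_sum_monomial_le k a d

end

end Summit.ValiantsHypothesis.ValiantsHypothesis.Cruxes.NewtonTauWeak.AlignedPeeling
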